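import Mathlib.Analysis.Calculus.BumpFunction.Normed
import Mathlib.Analysis.Calculus.BumpFunction.InnerProduct
import Literature.Analysis.FluidPDE.PeriodicLeraySystem
import Literature.Analysis.FluidPDE.ForwardDSSMollifiedDrift
import Literature.Analysis.FluidPDE.NewtonKernel
import HarnessLib

/-!
# Existence of suitable periodic weak solutions of the Leray system ([BT1] Thm 2.4): the printed
  proof decomposed — Lemma 2.5, the mollified approximants (Lemma 2.6 and the proof), the limit

Analysis/FluidPDE fact file under the named fact
`Literature.Analysis.FluidPDE.bradshawTsai2017_thm_2_4_periodic` (`PeriodicLeraySystem.lean`):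

> **Bradshaw–Tsai, Ann. Henri Poincaré 18 (2017) = arXiv:1510.07504 [BT1], Theorem 2.4.** Assume
> `U₀(y,s)` satisfies Assumption 2.1 with `q = 10/3`. Then (2.1) has a periodic suitable weak
> solution `(u,p)` in `ℝ⁴` with period `T` [and, from its proof, `p ∈ L^{5/3}(ℝ³ × [0,T])`].

Its printed proof (loc. cit. §2) is a complete weak-solution theory — cut-off of the profile
with a Newtonian-potential divergence correction, Galerkin approximation of a mollified perturbed
system with Brouwer's fixed point theorem for the period map, energy estimates, two compactness
passages, the pressure by Riesz transforms and Calderón–Zygmund bounds, suitability "as in [CKN]" —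
none of which Mathlib has. This file vendors the proof's **four printed way-points** as named facts
with the source's numbering, over real definitions of the objects they speak about, and **proves
the assembly** `bradshawTsai2017_thm_2_4_periodic_of_parts`, so that the trust base of Thm 2.4 in
the tree becomes four independently attackable statements of very different weight:

1. **Lemma 2.5** (revised asymptotic profile; `bradshawTsai2017_lemma_2_5`): for `U₀` under
   Assumption 2.1 with `q ∈ (3,∞]` and any `α ∈ (0,1)` there is `R₀ ≥ 1` such that
   `W = ξU₀ + w`, `ξ(y) = Z(y/R₀)`, `w = ∇(4π|·|)⁻¹ ∗ (∇ξ·U₀)` (the two displays of Lemma 2.5, here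
   the explicit `BradshawTsai2017.revisedProfile R₀ U₀`) is `C¹`, `T`-periodic, divergence free,
   with `U₀ − W ∈ L^∞(0,T;L²)`, `‖W‖_{L^∞ L^q} ≤ α`, `W ∈ L^∞ L⁴`, `LW ∈ L^∞(0,T;H⁻¹)` — elementary
   potential theory (the printed proof quotes Calderón–Zygmund and Hardy–Littlewood–Sobolev, but
   the pointwise kernel bounds for `w` and `∇w` it also proves suffice);
2. **the gradient bound `|∇w(y)| ≤ C(R₀,U₀)/(1+|y|³)` of its proof**
   (`bradshawTsai2017_lemma_2_5_gradient`): `∇(U₀ − W) ∈ L^∞(0,T;L²)` — used silently by the proof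
   of Thm 2.4 (Def. 2.2 asks `u − U₀ ∈ L²(0,T;H¹)` of `u = U + W`) and not listed among the
   conclusions of Lemma 2.5; it follows from that bound and `U₀ ∈ C¹`;
3. **Lemma 2.6 with the first part of the proof of Thm 2.4** (`bradshawTsai2017_thm_2_4_mollified`):
   for `W` as in Lemma 2.5 with `α` small and every `ε > 0`, a `T`-periodic weak solution `U_ε` of
   the mollified perturbed Leray system with `‖U_ε‖_{L^∞L² ∩ L²H¹}` bounded independently of `ε`
   (Galerkin + Brouwer, Lemma 2.6; "a standard limiting process"), a pressure `p_ε` with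
   `‖p_ε‖_{L^{5/3}(ℝ³×[0,T])} ≤ C` independently of `ε` (Riesz transforms, uniqueness for the forced
   Stokes system, Calderón–Zygmund) such that `(u_ε, p_ε) = (U_ε + W, p_ε)` solves the mollified
   system in `𝒟'` and satisfies its local energy balance ("the approximating solutions `(u_ε,p_ε)`
   all satisfy the local energy equality") — the PDE core;
4. **the last part of the proof of Thm 2.4, the limit `ε → 0`** (`bradshawTsai2017_thm_2_4_limit`):
   any such sequence of approximants with `ε_k → 0` and common bounds has a subsequence converging
   (weakly in `L²(0,T;X)`, strongly in `L²(0,T;L²(K))`, weakly in `L²` for all `s`, `p_{ε_k} ⇀ p` in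
   `L^{5/3}`) to a suitable periodic weak solution `(u,p)` of (2.1) with `p ∈ L^{5/3}(ℝ³ × [0,T])`,
   suitability "as in [CKN]" — a compactness theorem.

## Contents

* `BradshawTsai2017.cutoffZ`, `cutoffScaled R` (`ξ_R(y) = Z(y/R)`), `profileCorrector R U₀` (`w` of
  Lemma 2.5, over the tree's Newtonian kernel `newtonKernel = Γ = −(4π|·|)⁻¹` of `NewtonKernel`:
  `∇_y(4π|y−z|)⁻¹ = −∇Γ(y−z)`), `revisedProfile R U₀` (`W = ξU₀ + w`); `lerayPairing W s ζ = ⟨LW(s), ζ⟩` (the pairing defined after Assumption 2.1,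
  the integrand of `ProfileAssumption.leray`); `mollify η ε U` (`η_ε * U(s)`,
  `η_ε = ε⁻³η(·/ε)` = the tree's `BradshawTsai2019.scaledMollifier η ε`).
* `BradshawTsai2017.IsRevisedProfile T q α W`: "the conclusions of Lemma 2.5" on `W` itself (the
  hypothesis of Lemma 2.6); `IsMollifyingKernel η` ("`η ∈ C₀^∞`, `∫η = 1`");
  `IsMollifiedPeriodicWeakSolution T W η ε C U p`: a `T`-periodic weak solution of the mollified
  perturbed Leray system with pressure, bounds `C`, and the local energy balance of `(U + W, p)`.
* The four facts and the proved assembly; non-vacuity of the three structures; unfolding lemmas.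

## Design notes

* *`α = 1/4` versus `α ≤ α₀`.* Lemma 2.6 and the proof of Thm 2.4 take "`W` as in Lemma 2.5 with
  `α = 1/4`", which makes the step "`|(U_k·∇W, U_k)| ≤ ⅛‖U_k‖²_{H¹}`" of the proof of Lemma 2.6
  depend on the size of the Hölder–Sobolev constant in `|(U·∇U, W)| ≤ c‖W‖_{L^{10/3}}‖U‖²_{H¹}`
  (true with the sharp constant).
  Fact 3 is stated with "some `α₀ ∈ (0,1)`" in place of `1/4` — implied by the printed statement,
  provable with any Sobolev constant, and all the assembly needs since Lemma 2.5 holds for every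
  `α ∈ (0,1)`.
* *The local energy balance of the approximants* is recorded as the inequality "`≤`" in the form
  the [CKN] argument consumes (only lower semicontinuity survives the limit anyway): for
  `u = U + W`, `b = W + η_ε * U`, `0 ≤ ψ ∈ C_c^∞(ℝ⁴)`,
  `∫∫ (½|u|² + |∇u|²)ψ ≤ ∫∫ ½|u|²(∂ₛψ + Δψ) + ∫∫ (½|u|²((b − y)·∇ψ) + p(u·∇ψ)) − ∫∫ ((U − η_ε*U)·∇W)·u ψ`
  (multiply `Lu + b·∇U + u·∇W + ∇p = 0`, the equation of `u_ε`, by `uψ`; `b·∇U = b·∇u − b·∇W` and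
  `u − b = U − η_ε * U`); at `ε = 0` (`b = u`) this is (2.4).
* *The weak forms.* The weak formulation of the mollified system ("`d/ds (U,f) = −(∇U,∇f) +
  (U + y·∇U, f) − ((η_ε*U)·∇U, f) − (W·∇U + U·∇W, f) − ⟨ℛ(W), f⟩` … for all `f ∈ 𝒟_T` and a.e.
  `s`") is rendered, like the weak form of Def. 2.2 in `IsSuitablePeriodicWeakSolution`, integrated
  over a period against `f ∈ 𝒟_T` with one weak spatial gradient `G = ∇U` on `ℝ × ℝ³`:
  `∫₀ᵀ ( ∫ (⟪U,∂ₛf⟫ − G:Df + ⟪U + Gy − Gb − DW U − DW W, f⟫) − ⟨LW, f⟩ ) ds = 0`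
  (`⟨ℛ(W), f⟩ = ⟨LW, f⟩ + (W·∇W, f)`, `ℛ(W) = LW + W·∇W`); the equation "in the sense of
  distributions" has all derivatives on the test field (`(b·∇U, ψ) = −(U,(b·∇)ψ)`,
  `(u·∇W, ψ) = −(W,(u·∇)ψ)` by `div b = div u = 0`), the shape of
  `IsSuitablePeriodicWeakSolution.distributional`.
* *Bounds for every `s`.* The `L^∞(0,T;L²)` bound on `U_ε` is stated for every `s`, as the limit
  structure states `u − U₀ ∈ L^∞ L²` for every `s` (the weak `L²` limits of the proof are taken "for
  all `s ∈ [0,T]`"; for pointwise-a.e. limit representatives the everywhere bound passes on by Fatou).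
* *Fact 4 is stated for sequences* `ε_k → 0⁺` of approximants with a common bound (the printed text
  extracts "a sequence `{U_{ε_k}}` of elements of `{U_ε}`"; the argument is the same for any such
  sequence). Fact 3 fixes nothing about `η` beyond "`η ∈ C₀^∞` satisfying `∫η dy = 1`", and the
  cut-off `Z` of Lemma 2.5 ("Fix `Z ∈ C^∞(ℝ³)` with `0 ≤ Z ≤ 1`, `Z(x) = 1` for `|x| > 2` and
  `Z(x) = 0` for `|x| < 1`") is fixed here as `1 −` Mathlib's bump `ContDiffBump ⟨1, 2⟩`, one
  admissible choice.
* *Locators.* Equation numbers of [BT1] §2 beyond (2.1) (the system) and (2.4) (the local energy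
  inequality of Def. 2.3) are not used in the citations of this file; displays are located by the
  lemma/proof they belong to.
* Not here (next layer down): the Galerkin system of ODEs and Lemma 2.6 proper (finite-dimensional;
  Brouwer's theorem is `Literature.Topology.Euclidean.BrouwerFixedPoint`), the Riesz-transform
  pressure formula `p̃_ε = Σ R_iR_j[(η_ε*U_i)U_j + W_iU_j + U_iW_j + W_iW_j]` with its `L^{5/3}`
  bound, the Stokes uniqueness lemma of the proof of Thm 2.4.

## Mathlib / tree search

Reused, nothing redefined: `ProfileAssumption`, `IsPeriodicDivFreeTest`,
`IsSuitablePeriodicWeakSolution`, `frobeniusInner`, `bradshawTsai2017_thm_2_4_periodic`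
(`PeriodicLeraySystem`); `IsSpaceTimeTestOn`, `timeDeriv`, `HasWeakSpatialGradientOn`,
`frobeniusNormSq`, `convect`, `VectorCalculus.divergence/IsDivFree`, `IsWeaklyDivFree`
(`WeakSolution`, `SuitableWeak`, `VectorCalculus`); `FunctionSpaces.IsTestFunctionOn`;
`BradshawTsai2019.scaledMollifier` (`ForwardDSSMollifiedDrift`, `η_δ = δ⁻ⁿη(·/δ)`); `newtonKernel`
with `fderiv_newtonKernel_apply` (`NewtonKernel`; the potential-theoretic toolkit for the discharge
of Lemma 2.5 is `NewtonPotentialHolder`/`DivFormPotential`: `newtonKernelGrad`, `IsSingularKernel`);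
Mathlib's
`ContDiffBump`/`ContDiffBump.normed` (the cut-off `Z` and the existence of a mollifying kernel) and
`MeasureTheory.convolution`. `lean search 'revisedProfile|lerayPairing|MollifiedPeriodic|lemma_2_5|lemma_2_6'`:
no prior rendering of [BT1] Lemmas 2.5–2.6 or of the approximants of Thm 2.4 (the tree's
`BradshawTsai2019.IsMollifiedApproximant` records Bradshaw–Tsai *2019*'s physical-variables scheme
(3.5), whole drift mollified, a different system).

## References

* Z. Bradshaw, T.-P. Tsai, *Forward discretely self-similar solutions of the Navier–Stokes
  equations II*, Ann. Henri Poincaré 18 (2017) 1095–1119 = arXiv:1510.07504, §2: Assumption 2.1 and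
  the pairing `⟨LW, ζ⟩`, Definitions 2.2–2.3, Thm 2.4, the cut-off `Z`, `ξ_R`, Lemma 2.5 and its
  proof, the perturbed and mollified Leray systems with `ℛ(W)` and the weak formulation, the
  Galerkin system, Lemma 2.6 and its proof, proof of Thm 2.4 (limit `k → ∞`, the pressure `p̃_ε`,
  Stokes uniqueness, the `L^{5/3}` bound, limit `ε → 0`, suitability) [BradshawTsai2017AHP].
* L. Caffarelli, R. Kohn, L. Nirenberg, CPAM 35 (1982), §2 and Appendix [CaffarelliKohnNirenberg1982].
-/

noncomputable section

open MeasureTheory Set Function Filter Topology TopologicalSpace Metric Module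
open scoped NNReal ENNReal InnerProductSpace RealInnerProductSpace Laplacian Convolution

namespace Literature.Analysis.FluidPDE

/-- Local notation for physical space `ℝ³ = EuclideanSpace ℝ (Fin 3)`. -/
local notation "ℝ³" => EuclideanSpace ℝ (Fin 3)

namespace BradshawTsai2017

/-! ## Lemma 2.5: the revised asymptotic profile `W = ξU₀ + w` -/

/-- The bump `1 − Z` behind the cut-off of [BT1] Lemma 2.5: Mathlib's smooth bump centred at `0`
with `rIn = 1`, `rOut = 2` (equal to `1` on `|y| ≤ 1`, to `0` on `|y| ≥ 2`, values in `[0,1]`). [cite: BradshawTsai2017AHP, §2 before Lemma 2.5] -/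
def cutoffBump : ContDiffBump (0 : ℝ³) := ⟨1, 2, one_pos, one_lt_two⟩

/-- **The cut-off `Z`** of [BT1] §2: "Fix `Z ∈ C^∞(ℝ³)` with `0 ≤ Z ≤ 1`, `Z(x) = 1` for `|x| > 2`
and `Z(x) = 0` for `|x| < 1`" — here the admissible choice `Z = 1 − cutoffBump`. [cite: BradshawTsai2017AHP, §2 before Lemma 2.5] -/
def cutoffZ (y : ℝ³) : ℝ := 1 - cutoffBump y

/-- **The scaled cut-off** `ξ_R(y) = Z(y/R)` ([BT1] §2: "For a given `R > 0`, let
`ξ_R(y) = Z(y/R)`"; `ξ = ξ_{R₀}` in Lemma 2.5). [cite: BradshawTsai2017AHP, §2 before Lemma 2.5] -/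
def cutoffScaled (R : ℝ) (y : ℝ³) : ℝ := cutoffZ (R⁻¹ • y)

/-- **The divergence correction `w`** of [BT1] Lemma 2.5:
`w(y,s) = ∫ ∇_y (4π|y−z|)⁻¹ (∇_zξ(z) · U₀(z,s)) dz = −∫ (∇ξ · U₀)(z,s) ∇Γ(y − z) dz` with `ξ = ξ_R`
and the tree's Newtonian kernel `Γ = newtonKernel = −(4π|·|)⁻¹` (`∇Γ(x) = x/(4π|x|³)` off the
origin, `fderiv_newtonKernel_apply`; time `s` first; "`w = ∇(−Δ)⁻¹(∇ξ·U₀)`", proof of Lemma 2.5). [cite: BradshawTsai2017AHP, Lemma 2.5 (definition of w)] -/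
def profileCorrector (R : ℝ) (U₀ : ℝ → ℝ³ → ℝ³) (s : ℝ) (y : ℝ³) : ℝ³ :=
  -∫ z, ⟪gradient (cutoffScaled R) z, U₀ s z⟫ • gradient newtonKernel (y - z)

/-- **The revised asymptotic profile** of [BT1] Lemma 2.5: `W(y,s) = ξ(y)U₀(y,s) + w(y,s)`,
`ξ = ξ_R`, `w = profileCorrector R U₀`. [cite: BradshawTsai2017AHP, Lemma 2.5 (definition of W)] -/
def revisedProfile (R : ℝ) (U₀ : ℝ → ℝ³ → ℝ³) (s : ℝ) (y : ℝ³) : ℝ³ :=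
  cutoffScaled R y • U₀ s y + profileCorrector R U₀ s y

/-- Unfolding `revisedProfile`. [cite: BradshawTsai2017AHP, Lemma 2.5 (definition of W)] -/
theorem revisedProfile_apply (R : ℝ) (U₀ : ℝ → ℝ³ → ℝ³) (s : ℝ) (y : ℝ³) :
    revisedProfile R U₀ s y = cutoffScaled R y • U₀ s y + profileCorrector R U₀ s y := rfl

/-- `Z` takes values in `[0,1]`. [cite: BradshawTsai2017AHP, §2 before Lemma 2.5] -/
theorem cutoffZ_mem_Icc (y : ℝ³) : cutoffZ y ∈ Icc (0 : ℝ) 1 :=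
  ⟨sub_nonneg.2 cutoffBump.le_one, sub_le_self _ cutoffBump.nonneg⟩

/-- `Z(y) = 0` for `|y| ≤ 1`. [cite: BradshawTsai2017AHP, §2 before Lemma 2.5] -/
theorem cutoffZ_eq_zero {y : ℝ³} (hy : ‖y‖ ≤ 1) : cutoffZ y = 0 := by
  rw [cutoffZ, cutoffBump.one_of_mem_closedBall (by simpa [cutoffBump] using hy), sub_self]

/-- `Z(y) = 1` for `|y| ≥ 2`. [cite: BradshawTsai2017AHP, §2 before Lemma 2.5] -/
theorem cutoffZ_eq_one {y : ℝ³} (hy : 2 ≤ ‖y‖) : cutoffZ y = 1 := by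
  rw [cutoffZ, cutoffBump.zero_of_le_dist (by simpa [cutoffBump] using hy), sub_zero]

/-- `Z` is smooth. [cite: BradshawTsai2017AHP, §2 before Lemma 2.5] -/
theorem contDiff_cutoffZ {n : ℕ∞} : ContDiff ℝ n cutoffZ :=
  contDiff_const.sub cutoffBump.contDiff

/-- `ξ_R(y) = 0` for `|y| ≤ R` (`R > 0`). [cite: BradshawTsai2017AHP, §2 before Lemma 2.5] -/
theorem cutoffScaled_eq_zero {R : ℝ} (hR : 0 < R) {y : ℝ³} (hy : ‖y‖ ≤ R) :
    cutoffScaled R y = 0 := by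
  refine cutoffZ_eq_zero ?_
  rw [norm_smul, Real.norm_eq_abs, abs_of_pos (inv_pos.2 hR), inv_mul_le_iff₀ hR, mul_one]
  exact hy

/-- `ξ_R(y) = 1` for `|y| ≥ 2R` (`R > 0`). [cite: BradshawTsai2017AHP, §2 before Lemma 2.5] -/
theorem cutoffScaled_eq_one {R : ℝ} (hR : 0 < R) {y : ℝ³} (hy : 2 * R ≤ ‖y‖) :
    cutoffScaled R y = 1 := by
  refine cutoffZ_eq_one ?_
  rw [norm_smul, Real.norm_eq_abs, abs_of_pos (inv_pos.2 hR), le_inv_mul_iff₀ hR]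
  linarith

/-- `ξ_R` is smooth. [cite: BradshawTsai2017AHP, §2 before Lemma 2.5] -/
theorem contDiff_cutoffScaled (R : ℝ) {n : ℕ∞} : ContDiff ℝ n (cutoffScaled R) :=
  contDiff_cutoffZ.comp (contDiff_const_smul _)

/-- The profile of the zero datum is zero: `revisedProfile R 0 = 0`. [folklore] -/
@[simp]
theorem revisedProfile_zero (R : ℝ) : revisedProfile R (0 : ℝ → ℝ³ → ℝ³) = 0 := by
  funext s y
  simp [revisedProfile, profileCorrector]

/-! ## The pairing `⟨LW, ζ⟩` and the class "conclusions of Lemma 2.5" -/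

/-- **[BT1] §2, after Assumption 2.1: the pairing `⟨LW, ζ⟩ = (∂ₛW − W − y·∇W, ζ) + (∇W, ∇ζ)`** of
the Leray operator "`LW = ∂ₛW − ΔW − W − y·∇W`" applied to a `C¹` profile `W` (time `s` first) at
time `s`, against `ζ : ℝ³ → ℝ³` (`(∇W,∇ζ) = ∫ ∇W : ∇ζ`, `y·∇W = DW(y)y`) — the integrand of the
accepted `ProfileAssumption.leray`. [cite: BradshawTsai2017AHP, §2 (the pairing ⟨LW,ζ⟩ after Assumption 2.1)] -/
def lerayPairing (W : ℝ → ℝ³ → ℝ³) (s : ℝ) (ζ : ℝ³ → ℝ³) : ℝ :=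
  ∫ y, (⟪timeDeriv W s y - W s y - fderiv ℝ (W s) y y, ζ y⟫ +
    frobeniusInner (fderiv ℝ (W s) y) (fderiv ℝ ζ y))

/-- `⟨L0, ζ⟩ = 0`. [folklore] -/
@[simp]
theorem lerayPairing_zero (s : ℝ) (ζ : ℝ³ → ℝ³) : lerayPairing (0 : ℝ → ℝ³ → ℝ³) s ζ = 0 := by
  simp [lerayPairing]

/-- The `H¹(ℝ³)` norm of a (test) field, `(∫|ζ|² + ∫|∇ζ|²)^{1/2}`, against which `H⁻¹` bounds are
expressed. [folklore] -/
def h1Norm (ζ : ℝ³ → ℝ³) : ℝ :=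
  Real.sqrt ((∫ y, ‖ζ y‖ ^ 2) + ∫ y, frobeniusNormSq (fderiv ℝ ζ y))

/-- **"`W` satisfies the conclusions of Lemma 2.5" with exponent `q` and smallness `α`** — the
standing hypothesis of [BT1] Lemma 2.6 and of the proof of Thm 2.4 on the perturbation profile, as
a predicate on `W` alone (time `s` first): "`W` is locally continuously differentiable in `y` and
`s`, `T`-periodic, divergence free, … `‖W‖_{L^∞(0,T;L^q(ℝ³))} ≤ α`,
`‖W‖_{L^∞(0,T;L⁴(ℝ³))} ≤ c(R₀,U₀)`, and `‖LW‖_{L^∞(0,T;H⁻¹(ℝ³))} ≤ c(R₀,U₀)`, where `LW` is given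
in [the display after Assumption 2.1]". The `H⁻¹` bound is `|⟨LW(s), ζ⟩| ≤ c‖ζ‖_{H¹}` for test
fields `ζ` (dense in `H¹ = H¹₀(ℝ³)`); the bounds hold for every `s` (continuity and periodicity). The
clause `U₀ − W ∈ L^∞(0,T;L²)` relating `W` to the profile is kept apart (see
`bradshawTsai2017_lemma_2_5`). [cite: BradshawTsai2017AHP, Lemma 2.5 (the three bounds)] -/
structure IsRevisedProfile (T : ℝ) (q : ℝ≥0∞) (α : ℝ) (W : ℝ → ℝ³ → ℝ³) : Prop where
  /-- `W` is continuously differentiable in `(s, y)`. -/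
  contDiff : ContDiff ℝ 1 (uncurry W)
  /-- `W` is `T`-periodic in `s`. -/
  periodic : ∀ s y, W (s + T) y = W s y
  /-- `W(s)` is divergence free for every `s`. -/
  divFree : ∀ s, VectorCalculus.IsDivFree (W s)
  /-- `‖W(s)‖_{L^q} ≤ α` for every `s`. -/
  small : ∀ s, eLpNorm (W s) q volume ≤ ENNReal.ofReal α
  /-- `W ∈ L^∞(0,T;L⁴(ℝ³))`. -/
  memL4 : ⨆ s, eLpNorm (W s) 4 volume < ∞
  /-- `LW ∈ L^∞(0,T;H⁻¹(ℝ³))`: `|⟨LW(s), ζ⟩| ≤ c‖ζ‖_{H¹}` for all test fields `ζ`. -/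
  leray_dual : ∃ c : ℝ≥0, ∀ s, ∀ ζ : ℝ³ → ℝ³,
    FunctionSpaces.IsTestFunctionOn (⊤ : Opens ℝ³) ζ → |lerayPairing W s ζ| ≤ c * h1Norm ζ

/-- **Non-vacuity**: the zero profile satisfies the conclusions of Lemma 2.5 for every `T`, `q`
and `α` (`‖0‖_{L^q} = 0 ≤ ofReal α`). [folklore] -/
theorem isRevisedProfile_zero (T : ℝ) (q : ℝ≥0∞) (α : ℝ) :
    IsRevisedProfile T q α (0 : ℝ → ℝ³ → ℝ³) where
  contDiff := by rw [uncurry_zero]; exact contDiff_const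
  periodic s y := rfl
  divFree s y := by simp [VectorCalculus.divergence]
  small s := by simp
  memL4 := by simp
  leray_dual := ⟨0, fun s ζ _ => by simp⟩

/-! ## The mollified perturbed Leray system and its periodic weak solutions -/

/-- **The mollifying kernels of [BT1]** (§2, before the mollified perturbed Leray equations): "For
all `ε > 0`, let `η_ε(y) = ε⁻³η(y/ε)` for some `η ∈ C₀^∞` satisfying `∫_{ℝ³} η dy = 1`" — `η` smooth,
compactly supported, of unit mass. [cite: BradshawTsai2017AHP, §2 (the mollifier η_ε, after Lemma 2.5)] -/
structure IsMollifyingKernel (η : ℝ³ → ℝ) : Prop where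
  /-- `η` is smooth. -/
  contDiff : ContDiff ℝ (⊤ : ℕ∞) η
  /-- `η` has compact support. -/
  hasCompactSupport : HasCompactSupport η
  /-- `∫ η = 1`. -/
  integral_eq_one : ∫ y, η y = 1

/-- **Existence of a mollifying kernel** (a normalised smooth bump). [folklore] -/
theorem exists_isMollifyingKernel : ∃ η : ℝ³ → ℝ, IsMollifyingKernel η :=
  ⟨cutoffBump.normed volume, cutoffBump.contDiff_normed, cutoffBump.hasCompactSupport_normed,
    cutoffBump.integral_normed⟩

/-- **Spatial mollification** `(η_ε * U)(s, y) = ∫ η_ε(z) U(s, y − z) dz` of a time-dependent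
field at scale `ε`, `η_ε = ε⁻³η(·/ε)` being the tree's `BradshawTsai2019.scaledMollifier η ε`
([BT1] §2, the drift `W + η_ε * U` of the mollified perturbed Leray equations). [cite: BradshawTsai2017AHP, §2 (mollified perturbed Leray equations)] -/
def mollify (η : ℝ³ → ℝ) (ε : ℝ) (U : ℝ → ℝ³ → ℝ³) (s : ℝ) : ℝ³ → ℝ³ :=
  BradshawTsai2019.scaledMollifier η ε ⋆[ContinuousLinearMap.lsmul ℝ ℝ, volume] U s

/-- `(η_ε * U)(s, y) = ∫ η_ε(z) U(s, y − z) dz`. [cite: BradshawTsai2017AHP, §2 (mollified perturbed Leray equations)] -/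
theorem mollify_apply (η : ℝ³ → ℝ) (ε : ℝ) (U : ℝ → ℝ³ → ℝ³) (s : ℝ) (y : ℝ³) :
    mollify η ε U s y = ∫ z, BradshawTsai2019.scaledMollifier η ε z • U s (y - z) := by
  rw [mollify, convolution_lsmul]

/-- `η_ε * 0 = 0`. [folklore] -/
@[simp]
theorem mollify_zero (η : ℝ³ → ℝ) (ε : ℝ) : mollify η ε (0 : ℝ → ℝ³ → ℝ³) = 0 := by
  funext s
  exact convolution_zero

/-- **`T`-periodic weak solutions of the mollified perturbed Leray system with pressure and
bounds** — the objects the proof of [BT1] Thm 2.4 works with, for a perturbation profile `W`, a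
kernel `η`, a scale `ε`, a bound `C`, the unknown `U = U_ε` and the pressure `p = p_ε` (time `s`
first; write `u = U + W`, `b = W + η_ε * U`):
"there exists `T`-periodic `U ∈ L²(0,T;H¹₀(ℝ³))` (with norm bounded independently of `ε`) … The
limit `U_ε` is a periodic weak solution of the mollified perturbed Leray system"
`LU + (W + η_ε*U)·∇U + U·∇W + ∇p = −ℛ(W)`, `div U = 0`, "where the source term is
`ℛ(W) := ∂ₛW − ΔW − W − y·∇W + W·∇W`" (`= LW + W·∇W`), whose weak formulation is
"`d/ds (U,f) = −(∇U,∇f) + (U + y·∇U, f) − ((η_ε*U)·∇U, f) − (W·∇U + U·∇W, f) − ⟨ℛ(W), f⟩`, and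
holds for all `f ∈ 𝒟_T` and a.e. `s ∈ (0,T)`"; "`U_ε` are bounded independently of `ε` in
`L^∞(0,T;L²(ℝ³)) ∩ L²(0,T;H¹₀(ℝ³))`"; the pressure: "`‖p_ε‖_{L^{5/3}(ℝ³×[0,T])} ≤
C‖U_ε‖²_{L^{10/3}(ℝ³×[0,T])} + C‖W‖²_{L^{10/3}(ℝ³×[0,T])}`, which is finite and independent of `ε`",
`(u_ε, p_ε)` solving the mollified system in the sense of distributions ("`p_ε` is defined as a
distribution whenever `U_ε` is a weak solution", "`∇(p_ε − p̃_ε) = 0`. We may therefore replace `p_ε`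
by `p̃_ε`"); and "the approximating solutions `(u_ε, p_ε)` all satisfy the local energy equality",
recorded as the inequality consumed by the [CKN] argument (module docstring, *Design notes*): for
`0 ≤ ψ ∈ C_c^∞(ℝ⁴)`,
`∫∫ (½|u|² + |∇u|²)ψ ≤ ∫∫ ½|u|²(∂ₛψ + Δψ) + ∫∫ (½|u|²((b − y)·∇ψ) + p(u·∇ψ)) − ∫∫ ((U − η_ε*U)·∇W)·u ψ`.
Rendering as in `IsSuitablePeriodicWeakSolution`: one weak spatial gradient `G = ∇U` on `ℝ × ℝ³`
serves the `L²H¹` bound, the weak formulation (integrated over a period against `f ∈ 𝒟_T`,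
`(y·∇U, f) = ⟪Gy, f⟫`, `((W + η_ε*U)·∇U, f) = ⟪Gb, f⟫`, `(U·∇W, f) = ⟪DW U, f⟫`,
`⟨ℛ(W), f⟩ = ⟨LW, f⟩ + ⟪DW W, f⟫`) and the local energy balance (`∇u = G + DW`); the
distributional equation carries every derivative on the test field; the `L²` bound holds for every
`s`. [cite: BradshawTsai2017AHP, §2 (perturbed and mollified Leray systems, ℛ(W), weak formulation), Lemma 2.6, proof of Thm 2.4 (pressure bound, local energy equality)] -/
structure IsMollifiedPeriodicWeakSolution (T : ℝ) (W : ℝ → ℝ³ → ℝ³) (η : ℝ³ → ℝ) (ε : ℝ)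
    (C : ℝ≥0) (U : ℝ → ℝ³ → ℝ³) (p : ℝ → ℝ³ → ℝ) : Prop where
  /-- `U` is `T`-periodic in `s`. -/
  periodic : ∀ s y, U (s + T) y = U s y
  /-- `p` is `T`-periodic in `s`. -/
  periodic_pressure : ∀ s y, p (s + T) y = p s y
  /-- `div U = 0`: almost every slice is weakly divergence free. -/
  divFree : ∀ᵐ s : ℝ, FluidPDE.IsWeaklyDivFree (U s)
  /-- `‖U‖_{L^∞(0,T;L²)} ≤ C`, the bound holding for every `s`. -/
  energy_le : ∀ s : ℝ, ∫⁻ y, ‖U s y‖ₑ ^ 2 ≤ C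
  /-- `p` is locally integrable on `ℝ⁴`. -/
  locallyIntegrable_pressure : LocallyIntegrable (uncurry p) volume
  /-- `‖p‖_{L^{5/3}(ℝ³ × [0,T])}^{5/3} ≤ C`. -/
  pressure_le : ∫⁻ z in Ioo 0 T ×ˢ (univ : Set ℝ³), ‖p z.1 z.2‖ₑ ^ (5 / 3 : ℝ) ≤ C
  /-- `(u, p)`, `u = U + W`, solves `∂ₛu − Δu − u − y·∇u + b·∇U + u·∇W + ∇p = 0`,
  `b = W + η_ε * U`, in `𝒟'(ℝ × ℝ³)`:
  `∫∫ ⟪u, ∂ₛψ + Δψ − 2ψ − (y·∇)ψ⟫ + ⟪U, (b·∇)ψ⟫ + ⟪W, (u·∇)ψ⟫ + p div ψ = 0`. -/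
  distributional : ∀ ψ : ℝ → ℝ³ → ℝ³, FluidPDE.IsSpaceTimeTestOn (⊤ : Opens (ℝ × ℝ³)) ψ →
    ∫ z : ℝ × ℝ³, (⟪U z.1 z.2 + W z.1 z.2, timeDeriv ψ z.1 z.2⟫ +
      ⟪U z.1 z.2 + W z.1 z.2, Δ (ψ z.1) z.2⟫ -
      ⟪U z.1 z.2 + W z.1 z.2, (2 : ℝ) • ψ z.1 z.2 + fderiv ℝ (ψ z.1) z.2 z.2⟫ +
      ⟪U z.1 z.2, convect (W z.1 + mollify η ε U z.1) (ψ z.1) z.2⟫ +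
      ⟪W z.1 z.2, convect (U z.1 + W z.1) (ψ z.1) z.2⟫ +
      p z.1 z.2 * VectorCalculus.divergence (ψ z.1) z.2) = 0
  /-- Bundled under one weak spatial gradient `G = ∇U` on `ℝ × ℝ³`: (i) `G` is a weak spatial
  gradient of `U`; (ii) `‖∇U‖²_{L²(ℝ³ × (0,T))} ≤ C`; (iii) the weak formulation against `𝒟_T`,
  integrated over a period; (iv) the local energy balance of `(u, p)` for nonnegative
  `ψ ∈ C_c^∞(ℝ⁴)`. -/
  weakForm : ∃ G : ℝ → ℝ³ → ℝ³ →L[ℝ] ℝ³,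
    FluidPDE.HasWeakSpatialGradientOn (⊤ : Opens (ℝ × ℝ³)) U G ∧
    (∫⁻ z in Ioo 0 T ×ˢ (univ : Set ℝ³), ENNReal.ofReal (frobeniusNormSq (G z.1 z.2)) ≤ C) ∧
    (∀ f : ℝ → ℝ³ → ℝ³, IsPeriodicDivFreeTest T f →
      ∫ s in Ioo 0 T, ((∫ y, (⟪U s y, timeDeriv f s y⟫ -
          frobeniusInner (G s y) (fderiv ℝ (f s) y) +
          ⟪U s y + G s y y - G s y (W s y + mollify η ε U s y) -
            fderiv ℝ (W s) y (U s y) - fderiv ℝ (W s) y (W s y), f s y⟫)) -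
        lerayPairing W s (f s)) = 0) ∧
    (∀ ψ : ℝ → ℝ³ → ℝ, FluidPDE.IsSpaceTimeTestOn (⊤ : Opens (ℝ × ℝ³)) ψ → (∀ s y, 0 ≤ ψ s y) →
      ∫ s, ∫ y, (‖U s y + W s y‖ ^ 2 / 2 + frobeniusNormSq (G s y + fderiv ℝ (W s) y)) * ψ s y ≤
        ∫ s, ∫ y, (‖U s y + W s y‖ ^ 2 / 2 * (timeDeriv ψ s y + Δ (ψ s) y) +
          (‖U s y + W s y‖ ^ 2 / 2 * ⟪W s y + mollify η ε U s y - y, gradient (ψ s) y⟫ +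
            p s y * ⟪U s y + W s y, gradient (ψ s) y⟫) -
          ⟪fderiv ℝ (W s) y (U s y - mollify η ε U s y), U s y + W s y⟫ * ψ s y))

/-- **Non-vacuity**: for the zero profile, the trivial pair `(0, 0)` is a periodic weak solution of
the mollified system for every kernel, scale and bound (every integrand vanishes). [folklore] -/
theorem isMollifiedPeriodicWeakSolution_zero (T : ℝ) (η : ℝ³ → ℝ) (ε : ℝ) (C : ℝ≥0) :
    IsMollifiedPeriodicWeakSolution T (0 : ℝ → ℝ³ → ℝ³) η ε C (0 : ℝ → ℝ³ → ℝ³)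
      (0 : ℝ → ℝ³ → ℝ) where
  periodic s y := rfl
  periodic_pressure s y := rfl
  divFree := Eventually.of_forall fun s θ _ => by simp
  energy_le s := by simp
  locallyIntegrable_pressure := by
    rw [uncurry_zero]; exact (integrable_zero (ℝ × ℝ³) ℝ volume).locallyIntegrable
  pressure_le := by
    simp only [Pi.zero_apply, enorm_zero, ENNReal.zero_rpow_of_pos (by norm_num : (0:ℝ) < 5 / 3),
      lintegral_zero]
    exact bot_le
  distributional ψ _ := by simp
  weakForm := by
    refine ⟨0, hasWeakSpatialGradientOn_zero _, ?_, fun f _ => ?_, fun ψ _ _ => ?_⟩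
    · simp [frobeniusNormSq_zero]
    · simp
    · simp [frobeniusNormSq_zero, mollify_zero]

/-! ## The four printed way-points -/

/-- **[BT1] Lemma 2.5 (Revised asymptotic profile).** "Fix `q ∈ (3,∞]` and suppose `U₀` satisfies
Assumption 2.1 for this `q`. Let `Z ∈ C^∞(ℝ³)` be as above. For any `α ∈ (0,1)`, there exists
`R₀ = R₀(U₀,α) ≥ 1` so that letting `ξ(y) = Z(y/R₀)` and setting `W(y,s) = ξ(y)U₀(y,s) + w(y,s)`,
where `w(y,s) = ∫ ∇_y (4π|y−z|)⁻¹ ∇_zξ(z)·U₀(z,s) dz`, we have that `W` is locally continuously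
differentiable in `y` and `s`, `T`-periodic, divergence free, `U₀ − W ∈ L^∞(0,T;L²(ℝ³))`, and
`‖W‖_{L^∞(0,T;L^q(ℝ³))} ≤ α`, `‖W‖_{L^∞(0,T;L⁴(ℝ³))} ≤ c(R₀,U₀)`, and
`‖LW‖_{L^∞(0,T;H⁻¹(ℝ³))} ≤ c(R₀,U₀)`, where … `c(R₀,U₀)` depends on `R₀` and quantities associated
with `U₀` which are finite by Assumption 2.1." Here `W = revisedProfile R₀ U₀` (with the fixed
admissible `Z = cutoffZ`), the conclusions on `W` are `IsRevisedProfile T q α W`, and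
`U₀ − W ∈ L^∞(0,T;L²)` is `sup_s ∫|U₀ − W|² < ∞`. [Proof: `div W = ∇ξ·U₀ + div w = 0`;
"`‖w‖_{L^q} ≤ c_q‖ξU₀‖_{L^q} ≤ c_qΘ(R₀)`" by Calderón–Zygmund, `R₀` so large that
`(1 + c_q)Θ(R₀) ≤ α`; the `L⁴` bound likewise; the `H⁻¹` bound from `LW = L(ξU₀) + Lw`,
`L(ξU₀) = −(Δξ)U₀ − 2(∇ξ·∇)U₀ − (y·∇ξ)U₀ ∈ L¹ ∩ L^∞` (using `LU₀ = 0`), `‖∂ₛw‖_{L²} ≤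
c‖∇ξ·∂ₛU₀‖_{L^{6/5}}` (Hardy–Littlewood–Sobolev), the pointwise bounds `|w(y)| ≲ R₀^{-3/4}‖U₀‖_{L⁴}`
(`|y| ≤ 4R₀`), `≲ |y|⁻²R₀^{5/4}‖U₀‖_{L⁴}` (`|y| > 4R₀`), and `|∇w(y)| ≤ C(R₀,U₀)/(1+|y|³)`.] [cite: BradshawTsai2017AHP, Lemma 2.5] -/
def _root_.Literature.Analysis.FluidPDE.bradshawTsai2017_lemma_2_5 : Prop :=
  ∀ {T : ℝ}, 0 < T → ∀ {q : ℝ≥0∞}, 3 < q → ∀ {U₀ : ℝ → ℝ³ → ℝ³}, ProfileAssumption T q U₀ →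
    ∀ {α : ℝ}, 0 < α → α < 1 →
      ∃ R₀ : ℝ, 1 ≤ R₀ ∧ IsRevisedProfile T q α (revisedProfile R₀ U₀) ∧
        ⨆ s : ℝ, (∫⁻ y, ‖U₀ s y - revisedProfile R₀ U₀ s y‖ₑ ^ 2) < ∞

/-- **[BT1] proof of Lemma 2.5, the gradient bound: `∇(U₀ − W) ∈ L^∞(0,T;L²)`.** For `U₀` under
Assumption 2.1 and any `R₀ ≥ 1`, `W = revisedProfile R₀ U₀` satisfies
`sup_s ∫ |∇U₀(s) − ∇W(s)|² < ∞`: indeed `U₀ − W = (1 − ξ)U₀ − w` with `(1 − ξ)U₀` compactly supported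
and `C¹`, and "We next show `|∇w(y)| ≤ C(R₀,U₀)/(1+|y|³)` … If `|y| ≤ 4R₀` … since `U₀` is
continuously differentiable we have `‖∇U₀‖_{L^∞(B_{2R₀})} < ∞` and thus
`‖∇w‖_{L^∞(B_{4R₀})} ≤ C(R₀,U₀)` … If `|y| ≥ 4R₀` then … `|∇w(y)| ≤ cR₀^{5/4}‖U₀‖_{L⁴}/|y|³`"
(proof of Lemma 2.5). Not among the printed conclusions of Lemma 2.5; it is what the class
`u − U₀ ∈ L²(0,T;H¹)` of Def. 2.2 requires of the solution `u = U + W` built in the proof of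
Thm 2.4. [cite: BradshawTsai2017AHP, proof of Lemma 2.5 (the bound on ∇w)] -/
def _root_.Literature.Analysis.FluidPDE.bradshawTsai2017_lemma_2_5_gradient : Prop :=
  ∀ {T : ℝ}, 0 < T → ∀ {q : ℝ≥0∞}, 3 < q → ∀ {U₀ : ℝ → ℝ³ → ℝ³}, ProfileAssumption T q U₀ →
    ∀ {R₀ : ℝ}, 1 ≤ R₀ →
      ⨆ s : ℝ, (∫⁻ y, ENNReal.ofReal (frobeniusNormSq
        (fderiv ℝ (U₀ s) y - fderiv ℝ (revisedProfile R₀ U₀ s) y))) < ∞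

/-- **[BT1] Lemma 2.6 with the proof of Theorem 2.4 (first part): the mollified approximants.**
For some absolute `α₀ ∈ (0,1)` (print: `α = 1/4`; see the module docstring): for every `T > 0`,
every `W` satisfying the conclusions of Lemma 2.5 with `q = 10/3` and `α ≤ α₀`, and every kernel
`η ∈ C₀^∞`, `∫η = 1`, there is `C` such that for every `ε > 0` the mollified perturbed Leray system
has a `T`-periodic weak solution `U_ε` with pressure `p_ε`, bounds `C` independent of `ε`, solving
the system in `𝒟'` and obeying the local energy balance
(`IsMollifiedPeriodicWeakSolution T W η ε C U_ε p_ε`). [Proof: **Lemma 2.6** (Construction of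
Galerkin approximations) — "Fix `T > 0` and let `W` satisfy the conclusions of Lemma 2.5 with
`α = 1/4`. 1. For any `k ∈ ℕ` and `ε > 0`, the system of ODEs [the Galerkin system over an
orthonormal basis `{a_k} ⊂ 𝒱` of `H`] has a `T`-periodic solution `b_k ∈ H¹(0,T)`. 2. Letting
`U_k = Σᵢ b_{ki}aᵢ`, we have `‖U_k‖_{L^∞(0,T;L²)} + ‖U_k‖_{L²(0,T;H¹)} < C` where `C` is independent
of both `ε` and `k`" (energy inequality `d/ds‖U_k‖² + ½‖U_k‖² + ½‖∇U_k‖² ≤ C₂` from the bounds of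
Lemma 2.5, Gronwall, and "the Brouwer fixed-point theorem" for the period map `b_k(0) ↦ b_k(T)` on
a closed ball `B_ρ^k`); then "through a standard limiting process … standard arguments (e.g. those
in [Temam])": `U_k → U_ε` weakly in `L²(0,T;X)`, strongly in `L²(0,T;L²(K))`, weakly in `L²` for
all `s ∈ [0,T]`; the pressure `p̃_ε = Σ R_iR_j[(η_ε*U_i)U_j + W_iU_j + U_iW_j + W_iW_j]` equals the
distributional pressure up to a constant by uniqueness for the forced non-stationary Stokes system
in the physical variables, and "apply the Calderon–Zygmund theory to obtain an a priori bound for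
`p_ε`"; the local energy equality of `(u_ε, p_ε)`.] [cite: BradshawTsai2017AHP, Lemma 2.6 and proof of Thm 2.4 (construction of U_ε and p_ε)] -/
def _root_.Literature.Analysis.FluidPDE.bradshawTsai2017_thm_2_4_mollified : Prop :=
  ∃ α₀ : ℝ, 0 < α₀ ∧ α₀ < 1 ∧
    ∀ {T : ℝ}, 0 < T → ∀ {α : ℝ}, 0 < α → α ≤ α₀ → ∀ {W : ℝ → ℝ³ → ℝ³},
      IsRevisedProfile T (10 / 3) α W → ∀ {η : ℝ³ → ℝ}, IsMollifyingKernel η →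
        ∃ C : ℝ≥0, ∀ {ε : ℝ}, 0 < ε →
          ∃ (U : ℝ → ℝ³ → ℝ³) (p : ℝ → ℝ³ → ℝ), IsMollifiedPeriodicWeakSolution T W η ε C U p

/-- **[BT1] proof of Theorem 2.4 (last part): the limit `ε → 0` and suitability.** Let `U₀` satisfy
Assumption 2.1 with `q = 10/3`, let `W` satisfy the conclusions of Lemma 2.5 (`q = 10/3`) with
`U₀ − W ∈ L^∞(0,T;L²)` and `∇(U₀ − W) ∈ L^∞(0,T;L²)`, let `η ∈ C₀^∞`, `∫η = 1`, and let
`(U_{ε_k}, p_{ε_k})` be periodic weak solutions of the mollified systems at scales `ε_k → 0⁺` with a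
common bound `C`. Then there is a suitable periodic weak solution `(u, p)` of (2.1) with period `T`
(Definitions 2.2–2.3) and `p ∈ L^{5/3}(ℝ³ × [0,T])`: "Because `U_ε` are bounded independently of `ε`
in `L^∞(0,T;L²(ℝ³)) ∩ L²(0,T;H¹₀(ℝ³))`, and `U_ε` is a weak solution of [the mollified perturbed
Leray equations] with `W` bounded by
Lemma 2.5, there exists … `U` … and a sequence … `U_{ε_k} → U` weakly in `L²(0,T;X)`, strongly in
`L²(0,T;H(K))` for all compact `K`, `U_{ε_k}(s) → U(s)` weakly in `L²` for all `s ∈ [0,T]` … Let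
`u = U + W`. … `p_{ε_k} → p` weakly in `L^{5/3}(ℝ³ × [0,T])` … this convergence is strong enough to
ensure that `(u,p)` solves (2.1) in the distributional sense. It remains to check that the pair
`(u,p)` is suitable. This follows as in [CKN] since the approximating solutions `(u_ε,p_ε)` all
satisfy the local energy equality." [cite: BradshawTsai2017AHP, proof of Thm 2.4 (limit ε → 0, suitability)] -/
def _root_.Literature.Analysis.FluidPDE.bradshawTsai2017_thm_2_4_limit : Prop :=
  ∀ {T : ℝ}, 0 < T → ∀ {U₀ W : ℝ → ℝ³ → ℝ³} {α : ℝ}, ProfileAssumption T (10 / 3) U₀ →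
    IsRevisedProfile T (10 / 3) α W →
    (⨆ s : ℝ, (∫⁻ y, ‖U₀ s y - W s y‖ₑ ^ 2)) < ∞ →
    (⨆ s : ℝ, (∫⁻ y, ENNReal.ofReal (frobeniusNormSq (fderiv ℝ (U₀ s) y - fderiv ℝ (W s) y)))) < ∞ →
    ∀ {η : ℝ³ → ℝ}, IsMollifyingKernel η →
    ∀ {C : ℝ≥0} {ε : ℕ → ℝ} {U : ℕ → ℝ → ℝ³ → ℝ³} {p : ℕ → ℝ → ℝ³ → ℝ},
      (∀ k, 0 < ε k) → Tendsto ε atTop (𝓝 0) →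
      (∀ k, IsMollifiedPeriodicWeakSolution T W η (ε k) C (U k) (p k)) →
      ∃ (u : ℝ → ℝ³ → ℝ³) (p : ℝ → ℝ³ → ℝ), IsSuitablePeriodicWeakSolution T U₀ u p ∧
        ∫⁻ z in Ioo 0 T ×ˢ (univ : Set ℝ³), ‖p z.1 z.2‖ₑ ^ (5 / 3 : ℝ) < ∞

/-- `3 < 10/3` in `ℝ≥0∞` (the exponent of Theorem 2.4 is admissible in Lemma 2.5). [folklore] -/
theorem three_lt_ten_div_three : (3 : ℝ≥0∞) < 10 / 3 := by
  rw [show (10 / 3 : ℝ≥0∞) = ((10 / 3 : ℝ≥0) : ℝ≥0∞) by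
    rw [ENNReal.coe_div (by norm_num)]; norm_num,
    show (3 : ℝ≥0∞) = ((3 : ℝ≥0) : ℝ≥0∞) from rfl, ENNReal.coe_lt_coe]
  rw [lt_div_iff₀ (by norm_num)]
  norm_num

/-- **Assembly: Lemma 2.5 + its gradient bound + the mollified approximants + the limit ⟹ Theorem 2.4**
(`bradshawTsai2017_thm_2_4_periodic` of `PeriodicLeraySystem`). Given `U₀` under Assumption 2.1
with `q = 10/3` and `T > 0`: take `α₀` from fact 3 and `W = revisedProfile R₀ U₀` from Lemma 2.5
with `α = α₀` ("we will decompose `u = W + U`, where `W` is as in Lemma 2.5 for `α = 1/4`"), its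
gradient class from the proof of Lemma 2.5,
a kernel `η`, the approximants `(U_ε, p_ε)` for `ε = 1/(k+1) → 0`, and pass to the limit. Hence
the trust base of [BT1] Thm 2.4 in the tree is `{bradshawTsai2017_lemma_2_5,
bradshawTsai2017_lemma_2_5_gradient, bradshawTsai2017_thm_2_4_mollified,
bradshawTsai2017_thm_2_4_limit}`. [cite: BradshawTsai2017AHP, proof of Thm 2.4] -/
theorem _root_.Literature.Analysis.FluidPDE.bradshawTsai2017_thm_2_4_periodic_of_parts
    (h25 : bradshawTsai2017_lemma_2_5) (h25' : bradshawTsai2017_lemma_2_5_gradient)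
    (hmol : bradshawTsai2017_thm_2_4_mollified) (hlim : bradshawTsai2017_thm_2_4_limit) :
    bradshawTsai2017_thm_2_4_periodic := by
  intro T hT U₀ hU₀
  obtain ⟨α₀, hα₀, hα₁, hB⟩ := hmol
  obtain ⟨R₀, hR₀, hW, hL2⟩ := h25 hT three_lt_ten_div_three hU₀ hα₀ hα₁
  have hgrad := h25' hT three_lt_ten_div_three hU₀ hR₀
  obtain ⟨η, hη⟩ := exists_isMollifyingKernel
  obtain ⟨C, hC⟩ := hB hT hα₀ le_rfl hW hη
  have hεpos : ∀ k : ℕ, (0 : ℝ) < 1 / ((k : ℝ) + 1) := fun k => by positivity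
  choose U p hUp using fun k : ℕ => hC (hεpos k)
  exact hlim hT hU₀ hW hL2 hgrad hη hεpos tendsto_one_div_add_atTop_nhds_zero_nat hUp

end BradshawTsai2017

end Literature.Analysis.FluidPDE

end
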